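import Literature.AlgebraicGeometry.HodgeTheory.QuaternionicQuarticPrimeSpecialisation
import Literature.AlgebraicGeometry.HodgeTheory.QuaternionicQuarticFamily
import Literature.AlgebraicGeometry.Motives.FamiliesVHS
import Summits.HodgeConjecture.HodgeConjecture.Theorems.PeriodDeficiencyQbarGenericIsHodgeGenericStubExistsMaximalAvoidingCountable
import Mathlib.Algebra.MvPolynomial.Funext
import HarnessLib

/-!
# Route `Q8SymplecticPowers`, crux K1Q «mechanism-v5» — glue S7, brick G7: the GENERICITY POLYNOMIALS (K1Q's `∃ G` device) — from
# countably many proper Zariski-closed subsets of the parameter space `W ⊆ 𝔸^{CIdx e}` to polynomials in the COEFFICIENTS of the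
# admissible pairs `(c, ψ)`, through the cosets of the symmetrisation `a ↦ (cOf a, ψOf a)`

Support file for crux K1Q (stmt-HodgeConjecture-24190; `--supports … --as helper`; nothing here closes an item). Prover seat
`hodge-nonav-19716-p2` (g14), owner of stub S7 `stub_transportHeredityQ`. The parameter map `a ↦ (cOf a, ψOf a)`, `ψOf a = ψ₀ + σ^*ψ₀`,
is onto the admissible pairs (`c` linear, `ψ` of degree `e − 1` and `σ`-symmetric) but NOT injective; K1Q's device `G` lives on the
coefficients of `(c, ψ)`. For an admissible `σ = (c, ψ)` the fibre of the parameter map is swept by `u ↦ A σ u`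
(`A σ u = (c, ψ/2 + R(u))`, `R(u) = Σ u_{d'} (x^{d'} − σ^* x^{d'})` antisymmetric), polynomial in `σ` for fixed `u` and in `u` for fixed `σ`:

* §1 points of `base W`: `left_comp_ι_eq` (a complex point `t` of `W` is `Spec (eval (coeffs W t))`), `exists_set_forall_mem_iff`
  (a subset Zariski closed on points is cut out by a set of polynomials in the coefficients), `exists_point_of_forall`
  (a coefficient vector outside the closed complement of `W` is the vector of a point).
* §2 the coset sweep `A σ u` and its two polynomial incarnations (`eval_bind₁`), `cOf_A`, `ψOf_A` (every `A σ u` lies over `(c, ψ)`),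
  `exists_A_eq` (every vector is swept).
* §3 **`exists_genericityPolynomials`** — for `W` with a complex point, countably many subsets `Bad j ⊆ W(ℂ)` Zariski closed on points
  and `≠ W(ℂ)`, and a non-zero `g₀` (the chart genericity element): polynomials `G i` on the `(c,ψ)`-coefficients, each non-vanishing at
  some admissible pair, such that every admissible pair off their zero sets is `(cOf a, ψOf a)` for the coefficient vector `a` of a
  point `t ∈ W(ℂ)` outside every `Bad j` with `g₀(a) ≠ 0` — via the tree's «`ℂ^s` is not a countable union of hypersurfaces»
  (`Theorems.exists_forall_eval_ne_zero`) applied in the coset variable `u`.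

HONEST FRAMING: algebra and point-set bookkeeping (axioms standard, no named fact); K1Q ∕ HC ∕ HC_AV NOT proved; item 24190 OPEN.

## References
* [Hartshorne1977] R. Hartshorne, Algebraic Geometry (1977), I §1 (Zariski topology of affine space), II Ex. 2.7 (points with values).
* [VoisinHodgeII2003] C. Voisin, Hodge Theory and Complex Algebraic Geometry II, CUP 2003, §5.3.3–§5.3.4 (Hodge loci; very general points).
-/

noncomputable section

set_option linter.dupNamespace false

namespace Summit.HodgeConjecture.HodgeConjecture.Theorems.Q8SymplecticPowersGenericityPolynomials

open CategoryTheory AlgebraicGeometry MvPolynomial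
open Literature.AlgebraicGeometry.Motives Literature.AlgebraicGeometry.Motives.UniversalHypersurface
open Literature.AlgebraicGeometry.HodgeTheory Literature.AlgebraicGeometry.HodgeTheory.Q8Family

/-! ### §1 Complex points of `base W` and their coefficient vectors -/

section Points

variable {e : ℕ} (W : (Spec (.of (ParamRing e))).Opens)

/-- A complex point `t` of `W ⊆ 𝔸^{CIdx e}` IS `Spec (eval (coeffs W t)) : Spec ℂ → Spec ℂ[a]` (prover-Bx's `hpt`).
[cite: Hartshorne1977, II Ex. 2.7] -/
theorem left_comp_ι_eq (t : ComplexPoints (base W)) :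
    t.left ≫ W.ι = Spec.map (CommRingCat.ofHom (MvPolynomial.eval (coeffs W t))) := by
  have hSpec : Spec.map (Spec.preimage (t.left ≫ W.ι)) = t.left ≫ W.ι := Spec.map_preimage _
  have hcomp : (Spec.preimage (t.left ≫ W.ι)).hom.comp (algebraMap ℂ (MvPolynomial (CIdx e) ℂ)) = algebraMap ℂ ℂ := by
    have hw : Spec.map (Spec.preimage (t.left ≫ W.ι)) ≫
        Spec.map (CommRingCat.ofHom (algebraMap ℂ (MvPolynomial (CIdx e) ℂ))) =
          Spec.map (CommRingCat.ofHom (algebraMap ℂ ℂ)) := by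
      rw [hSpec]
      exact (Category.assoc _ _ _).trans (Over.w t)
    rw [← Spec.map_comp] at hw
    have := congrArg CommRingCat.Hom.hom (Spec.map_injective hw)
    simpa using this
  have hφ : (Spec.preimage (t.left ≫ W.ι)).hom = MvPolynomial.eval (coeffs W t) := by
    refine MvPolynomial.ringHom_ext (fun r => ?_) (fun i => ?_)
    · rw [MvPolynomial.eval_C, ← MvPolynomial.algebraMap_eq]
      simpa using RingHom.congr_fun hcomp r
    · rw [MvPolynomial.eval_X]
      rfl
  rw [← hφ, CommRingCat.ofHom_hom, hSpec]

/-- For a ring homomorphism `χ : R → ℂ`, the contraction of the point of `Spec ℂ` lies on `V(S)` iff `χ` kills `S`. [folklore] -/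
theorem comap_mem_zeroLocus_iff {R : Type} [CommRing R] (χ : R →+* ℂ) (x : Spec (.of ℂ)) (S : Set R) :
    (Spec.map (CommRingCat.ofHom χ)) x ∈ PrimeSpectrum.zeroLocus S ↔ ∀ F ∈ S, χ F = 0 := by
  have h : (Spec.map (CommRingCat.ofHom χ)) x ∈ PrimeSpectrum.zeroLocus S ↔ ∀ F ∈ S, χ F ∈ x.asIdeal := Iff.rfl
  rw [h]
  refine forall₂_congr fun F _ => ?_
  rw [Ideal.eq_bot_of_prime x.asIdeal, Ideal.mem_bot]

/-- **A subset of `W(ℂ)` Zariski closed on points is cut out by a set of polynomials in the coefficient vector.**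
[cite: Hartshorne1977, I §1] -/
theorem exists_set_forall_mem_iff (Z : Set (ComplexPoints (base W))) (hZ : IsZariskiClosedOnPoints (base W) Z) :
    ∃ S : Set (ParamRing e), ∀ t : ComplexPoints (base W), t ∈ Z ↔ ∀ F ∈ S, MvPolynomial.eval (coeffs W t) F = 0 := by
  obtain ⟨Zc, hZc, rfl⟩ := hZ
  have hind : Topology.IsInducing W.ι.base := W.ι.isOpenEmbedding.isInducing
  obtain ⟨Cl, hCl, hZcCl⟩ := hind.isClosed_iff.mp hZc
  obtain ⟨S, rfl⟩ := (PrimeSpectrum.isClosed_iff_zeroLocus Cl).mp hCl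
  refine ⟨S, fun t => ?_⟩
  have h1 : t ∈ {P : ComplexPoints (base W) | P.pt ∈ Zc} ↔ W.ι.base t.pt ∈ PrimeSpectrum.zeroLocus S := by
    rw [← hZcCl]; rfl
  rw [h1]
  change (t.left ≫ W.ι) (IsLocalRing.closedPoint ℂ) ∈ PrimeSpectrum.zeroLocus S ↔ _
  rw [left_comp_ι_eq W t]
  exact comap_mem_zeroLocus_iff _ _ S

/-- **The complement of `W` in `𝔸^{CIdx e}`, on coefficient vectors**: there is a set `S∞` of polynomials such that a vector `a` is the
coefficient vector of a complex point of `W` iff some member of `S∞` does not vanish at `a`. [cite: Hartshorne1977, I §1 and II Ex. 2.7] -/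
theorem exists_set_exists_point_iff :
    ∃ S : Set (ParamRing e), ∀ a : CIdx e → ℂ,
      (∃ t : ComplexPoints (base W), coeffs W t = a) ↔ ¬ ∀ F ∈ S, MvPolynomial.eval a F = 0 := by
  obtain ⟨S, hS⟩ := (PrimeSpectrum.isClosed_iff_zeroLocus (W : Set (Spec (.of (ParamRing e))))ᶜ).mp W.isOpen.isClosed_compl
  refine ⟨S, fun a => ⟨?_, fun ha => ?_⟩⟩
  · rintro ⟨t, rfl⟩ hall
    let x₀ : Spec (.of ℂ) := IsLocalRing.closedPoint ℂ
    have hx₀ : (t.left ≫ W.ι) x₀ ∈ (W : Set _) := by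
      rw [Scheme.Hom.comp_apply]
      exact (t.left x₀ : W).2
    rw [left_comp_ι_eq W t] at hx₀
    have hmem := ((Set.ext_iff.1 hS) ((Spec.map (CommRingCat.ofHom (MvPolynomial.eval (coeffs W t)))) x₀)).2
      ((comap_mem_zeroLocus_iff _ x₀ S).2 hall)
    exact hmem hx₀
  · let g₀ : Spec (.of ℂ) ⟶ Spec (.of (ParamRing e)) := Spec.map (CommRingCat.ofHom (MvPolynomial.eval a))
    have hg₀ : Set.range g₀ ⊆ Set.range W.ι := by
      rintro _ ⟨x, rfl⟩
      rw [Scheme.Opens.range_ι]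
      by_contra hx
      have hx' := ((Set.ext_iff.1 hS) (g₀ x)).1 hx
      exact ha ((comap_mem_zeroLocus_iff _ x S).1 hx')
    obtain ⟨s₀, hs₀⟩ : ∃ s₀ : Spec (.of ℂ) ⟶ (W : Scheme), s₀ ≫ W.ι = g₀ := ⟨_, IsOpenImmersion.lift_fac W.ι g₀ hg₀⟩
    have hc : (MvPolynomial.eval a).comp (algebraMap ℂ (MvPolynomial (CIdx e) ℂ)) = algebraMap ℂ ℂ :=
      RingHom.ext fun r => by simp [MvPolynomial.algebraMap_eq]
    refine ⟨AlgPoints.mk (X := base W) s₀ ?_, ?_⟩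
    · calc s₀ ≫ (base W).hom
          = (s₀ ≫ W.ι) ≫ Spec.map (CommRingCat.ofHom (algebraMap ℂ (MvPolynomial (CIdx e) ℂ))) := (Category.assoc _ _ _).symm
        _ = Spec.map (CommRingCat.ofHom (algebraMap ℂ ℂ)) := by rw [hs₀, ← Spec.map_comp, ← CommRingCat.ofHom_comp, hc]
    · funext i
      change (Spec.preimage (s₀ ≫ W.ι)).hom (MvPolynomial.X i) = a i
      rw [hs₀, Spec.preimage_map, CommRingCat.hom_ofHom, MvPolynomial.eval_X]

end Points

/-! ### §2 The coset sweep of the symmetrisation `a ↦ (cOf a, ψOf a)` -/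

section Sweep

variable {e : ℕ}

/-- The coefficient of `x^d` in `Σ_{d'} x^{d'} · v(d')` is `v(d)` (monomials of one degree). [folklore] -/
theorem coeff_sum_monomial {n k : ℕ} (v : DegIndex n k → ℂ) (d : DegIndex n k) :
    coeff d.1 (∑ d' : DegIndex n k, monomial d'.1 (v d')) = v d := by
  classical
  rw [coeff_sum]
  simp only [coeff_monomial]
  rw [Finset.sum_eq_single d (fun b _ hb => if_neg fun h => hb (Subtype.ext h)) (fun h => absurd (Finset.mem_univ _) h), if_pos rfl]

/-- The antisymmetric forms `R_{d'} = x^{d'} − σ^* x^{d'}` are homogeneous of degree `e − 1`. [folklore] -/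
theorem isHomogeneous_R (d' : DegIndex 1 (e - 1)) :
    (monomial d'.1 (1 : ℂ) - rename (Equiv.swap (0 : Fin 3) 1) (monomial d'.1 (1 : ℂ))).IsHomogeneous (e - 1) :=
  (isHomogeneous_monomial _ d'.2).sub ((isHomogeneous_monomial _ d'.2).rename_isHomogeneous)

/-- `σ^*` is an involution on ternary forms. [folklore] -/
theorem rename_swap_rename_swap (p : MvPolynomial (Fin 3) ℂ) :
    rename (Equiv.swap (0 : Fin 3) 1) (rename (Equiv.swap (0 : Fin 3) 1) p) = p := by
  rw [rename_rename]
  have h : (⇑(Equiv.swap (0 : Fin 3) 1) ∘ ⇑(Equiv.swap (0 : Fin 3) 1)) = id := funext fun x => Equiv.swap_apply_self _ _ x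
  rw [h, rename_id]
  rfl

/-- `σ^* R_{d'} = −R_{d'}`. [folklore] -/
theorem rename_swap_R (d' : DegIndex 1 (e - 1)) :
    rename (Equiv.swap (0 : Fin 3) 1) (monomial d'.1 (1 : ℂ) - rename (Equiv.swap (0 : Fin 3) 1) (monomial d'.1 (1 : ℂ))) =
      -(monomial d'.1 (1 : ℂ) - rename (Equiv.swap (0 : Fin 3) 1) (monomial d'.1 (1 : ℂ))) := by
  rw [map_sub, rename_swap_rename_swap, neg_sub]

/-- **The sweep in the coset variable**: `Σ_d x^d (Σ_{d'} k_{d d'} u_{d'}) = Σ_{d'} u_{d'} R_{d'}`, with `k_{d d'} = coeff_d R_{d'}`. [folklore] -/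
theorem sum_monomial_sum_k_mul (u : DegIndex 1 (e - 1) → ℂ) :
    (∑ d : DegIndex 1 (e - 1), monomial d.1 (∑ d' : DegIndex 1 (e - 1),
        coeff d.1 (monomial d'.1 (1 : ℂ) - rename (Equiv.swap (0 : Fin 3) 1) (monomial d'.1 (1 : ℂ))) * u d')) =
      ∑ d' : DegIndex 1 (e - 1), C (u d') * (monomial d'.1 (1 : ℂ) - rename (Equiv.swap (0 : Fin 3) 1) (monomial d'.1 (1 : ℂ))) := by
  calc (∑ d : DegIndex 1 (e - 1), monomial d.1 (∑ d' : DegIndex 1 (e - 1),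
        coeff d.1 (monomial d'.1 (1 : ℂ) - rename (Equiv.swap (0 : Fin 3) 1) (monomial d'.1 (1 : ℂ))) * u d'))
      = ∑ d : DegIndex 1 (e - 1), ∑ d' : DegIndex 1 (e - 1), monomial d.1
          (coeff d.1 (monomial d'.1 (1 : ℂ) - rename (Equiv.swap (0 : Fin 3) 1) (monomial d'.1 (1 : ℂ))) * u d') := by
        refine Finset.sum_congr rfl fun d _ => ?_
        rw [map_sum]
    _ = ∑ d' : DegIndex 1 (e - 1), ∑ d : DegIndex 1 (e - 1), monomial d.1
          (coeff d.1 (monomial d'.1 (1 : ℂ) - rename (Equiv.swap (0 : Fin 3) 1) (monomial d'.1 (1 : ℂ))) * u d') :=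
        Finset.sum_comm
    _ = ∑ d' : DegIndex 1 (e - 1), C (u d') * (monomial d'.1 (1 : ℂ) - rename (Equiv.swap (0 : Fin 3) 1) (monomial d'.1 (1 : ℂ))) := by
        refine Finset.sum_congr rfl fun d' _ => ?_
        have h := sum_monomial_coeff_eq (n := 1) (d := e - 1) _ (isHomogeneous_R (e := e) d')
        calc (∑ d : DegIndex 1 (e - 1), monomial d.1
              (coeff d.1 (monomial d'.1 (1 : ℂ) - rename (Equiv.swap (0 : Fin 3) 1) (monomial d'.1 (1 : ℂ))) * u d'))
            = C (u d') * ∑ d : DegIndex 1 (e - 1), monomial d.1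
                (coeff d.1 (monomial d'.1 (1 : ℂ) - rename (Equiv.swap (0 : Fin 3) 1) (monomial d'.1 (1 : ℂ)))) := by
              rw [Finset.mul_sum]
              refine Finset.sum_congr rfl fun d _ => ?_
              rw [C_mul_monomial, mul_comm]
          _ = _ := by rw [h]

/-- Coefficients of the sweep: `coeff_d (Σ_{d'} u_{d'} R_{d'}) = Σ_{d'} k_{d d'} u_{d'}`. [folklore] -/
theorem coeff_sum_C_mul_R (u : DegIndex 1 (e - 1) → ℂ) (d : DegIndex 1 (e - 1)) :
    coeff d.1 (∑ d' : DegIndex 1 (e - 1), C (u d') * (monomial d'.1 (1 : ℂ) - rename (Equiv.swap (0 : Fin 3) 1) (monomial d'.1 (1 : ℂ)))) =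
      ∑ d' : DegIndex 1 (e - 1), coeff d.1 (monomial d'.1 (1 : ℂ) - rename (Equiv.swap (0 : Fin 3) 1) (monomial d'.1 (1 : ℂ))) * u d' := by
  rw [← sum_monomial_sum_k_mul, coeff_sum_monomial]

/-- **Every point of the coset lies over `(c, ψ)`**: for an admissible pair and every `u`, the swept vector `A σ u` has `cOf = c` and
`ψOf = ψ`. [folklore] -/
theorem cOf_ψOf_sweep {c ψ : MvPolynomial (Fin 3) ℂ} (hc : c.IsHomogeneous 1) (hψ : ψ.IsHomogeneous (e - 1))
    (hψσ : rename (Equiv.swap (0 : Fin 3) 1) ψ = ψ) (u : DegIndex 1 (e - 1) → ℂ) :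
    cOf (e := e) (Sum.elim (fun d : DegIndex 1 1 => c.coeff d.1) (fun d : DegIndex 1 (e - 1) => (1 / 2 : ℂ) * ψ.coeff d.1 +
        ∑ d' : DegIndex 1 (e - 1), coeff d.1 (monomial d'.1 (1 : ℂ) - rename (Equiv.swap (0 : Fin 3) 1) (monomial d'.1 (1 : ℂ))) * u d')) = c ∧
    ψOf (e := e) (Sum.elim (fun d : DegIndex 1 1 => c.coeff d.1) (fun d : DegIndex 1 (e - 1) => (1 / 2 : ℂ) * ψ.coeff d.1 +
        ∑ d' : DegIndex 1 (e - 1), coeff d.1 (monomial d'.1 (1 : ℂ) - rename (Equiv.swap (0 : Fin 3) 1) (monomial d'.1 (1 : ℂ))) * u d')) = ψ := by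
  constructor
  · -- `cOf = Σ_d x^d · coeff_d c = c`
    exact sum_monomial_coeff_eq (n := 1) (d := 1) c hc
  · -- `ψ₀ = ½ ψ + Σ u R`, `ψOf = ψ₀ + σ^* ψ₀ = ψ`
    set Ru := ∑ d' : DegIndex 1 (e - 1), C (u d') * (monomial d'.1 (1 : ℂ) - rename (Equiv.swap (0 : Fin 3) 1) (monomial d'.1 (1 : ℂ)))
      with hRu
    have hψ₀ : (∑ d : DegIndex 1 (e - 1), monomial d.1 ((1 / 2 : ℂ) * ψ.coeff d.1 +
        ∑ d' : DegIndex 1 (e - 1), coeff d.1 (monomial d'.1 (1 : ℂ) - rename (Equiv.swap (0 : Fin 3) 1) (monomial d'.1 (1 : ℂ))) * u d')) =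
        C (1 / 2 : ℂ) * ψ + Ru := by
      rw [hRu, ← sum_monomial_sum_k_mul]
      conv_rhs => rw [← sum_monomial_coeff_eq (n := 1) (d := e - 1) ψ hψ, Finset.mul_sum, ← Finset.sum_add_distrib]
      refine Finset.sum_congr rfl fun d _ => ?_
      rw [map_add, C_mul_monomial]
    have hswapRu : rename (Equiv.swap (0 : Fin 3) 1) Ru = -Ru := by
      rw [hRu, map_sum, ← Finset.sum_neg_distrib]
      refine Finset.sum_congr rfl fun d' _ => ?_
      rw [map_mul, rename_C, rename_swap_R, mul_neg]
    simp only [ψOf, Sum.elim_inr]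
    rw [hψ₀, map_add, map_mul, rename_C, hψσ, hswapRu]
    have h2 : C (1 / 2 : ℂ) * ψ + C (1 / 2 : ℂ) * ψ = ψ := by
      rw [← add_mul, ← C_add, show (1 / 2 : ℂ) + 1 / 2 = 1 by norm_num, C_1, one_mul]
    calc C (1 / 2 : ℂ) * ψ + Ru + (C (1 / 2 : ℂ) * ψ + -Ru) = C (1 / 2 : ℂ) * ψ + C (1 / 2 : ℂ) * ψ := by ring
      _ = ψ := h2

/-- `ψOf a` is `σ`-symmetric. [folklore] -/
theorem rename_swap_ψOf (a : CIdx e → ℂ) : rename (Equiv.swap (0 : Fin 3) 1) (ψOf a) = ψOf a := by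
  change rename _ (_ + rename _ _) = _ + rename _ _
  rw [map_add, rename_swap_rename_swap, add_comm]

/-- **Every coefficient vector is swept**: `a₀ = A σ₀ u₀` for the admissible pair `(cOf a₀, ψOf a₀)` and `u₀ = ½ a₀|_{ψ₀}`. [folklore] -/
theorem sweep_eq_self (a₀ : CIdx e → ℂ) :
    (Sum.elim (fun d : DegIndex 1 1 => (cOf a₀).coeff d.1) (fun d : DegIndex 1 (e - 1) => (1 / 2 : ℂ) * (ψOf a₀).coeff d.1 +
        ∑ d' : DegIndex 1 (e - 1), coeff d.1 (monomial d'.1 (1 : ℂ) - rename (Equiv.swap (0 : Fin 3) 1) (monomial d'.1 (1 : ℂ))) *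
          ((1 / 2 : ℂ) * a₀ (Sum.inr d'))) : CIdx e → ℂ) = a₀ := by
  funext v
  rcases v with d | d
  · exact coeff_sum_monomial (fun d' : DegIndex 1 1 => a₀ (Sum.inl d')) d
  · change (1 / 2 : ℂ) * (ψOf a₀).coeff d.1 + _ = a₀ (Sum.inr d)
    set P := ∑ d' : DegIndex 1 (e - 1), monomial d'.1 (a₀ (Sum.inr d')) with hP
    have hψOf : ψOf a₀ = P + rename (Equiv.swap (0 : Fin 3) 1) P := rfl
    have hRu : (∑ d' : DegIndex 1 (e - 1), C ((1 / 2 : ℂ) * a₀ (Sum.inr d')) *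
        (monomial d'.1 (1 : ℂ) - rename (Equiv.swap (0 : Fin 3) 1) (monomial d'.1 (1 : ℂ)))) =
        C (1 / 2 : ℂ) * (P - rename (Equiv.swap (0 : Fin 3) 1) P) := by
      rw [hP, map_sum, ← Finset.sum_sub_distrib, Finset.mul_sum]
      refine Finset.sum_congr rfl fun d' _ => ?_
      have hmon : monomial d'.1 (a₀ (Sum.inr d')) = C (a₀ (Sum.inr d')) * monomial d'.1 (1 : ℂ) := by
        rw [C_mul_monomial, mul_one]
      rw [hmon, C_mul, map_mul (rename (Equiv.swap (0 : Fin 3) 1)) (C (a₀ (Sum.inr d'))) (monomial d'.1 (1 : ℂ)), rename_C]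
      ring
    rw [← coeff_sum_C_mul_R, hRu, hψOf, coeff_C_mul, coeff_add, coeff_sub]
    have hPd : coeff d.1 P = a₀ (Sum.inr d) := by rw [hP]; exact coeff_sum_monomial (fun d' => a₀ (Sum.inr d')) d
    rw [hPd]
    ring

end Sweep

/-! ### §3 The genericity polynomials -/

/-- **G7 (K1Q's `∃ G` device through the cosets of the symmetrisation).** `W ⊆ 𝔸^{CIdx e}` open with a complex point; `Bad j ⊆ W(ℂ)`
(`j ∈ ℕ`) Zariski closed on points and `≠ W(ℂ)`; `g₀ ≠ 0`. Then there are polynomials `G i` in the coefficients of the admissible pairs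
`(c, ψ)` (`c` linear, `ψ` of degree `e − 1` and `σ`-symmetric), each non-vanishing at some admissible pair, such that every admissible
pair off all their zero sets is `(cOf a, ψOf a)` for the coefficient vector `a` of a complex point of `W` outside every `Bad j` and with
`g₀(a) ≠ 0`. [cite: Hartshorne1977, I §1] [cite: VoisinHodgeII2003, §5.3.3] -/
theorem exists_genericityPolynomials {e : ℕ} (W : (Spec (.of (ParamRing e))).Opens) (hne : Nonempty (ComplexPoints (base W)))
    (Bad : ℕ → Set (ComplexPoints (base W))) (hBad : ∀ j, IsZariskiClosedOnPoints (base W) (Bad j) ∧ Bad j ≠ Set.univ)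
    (g₀ : ParamRing e) (hg₀ : g₀ ≠ 0) :
    ∃ G : ℕ → MvPolynomial (CIdx e) ℂ,
      (∀ i, ∃ c ψ : MvPolynomial (Fin 3) ℂ, c.IsHomogeneous 1 ∧ ψ.IsHomogeneous (e - 1) ∧
        rename (Equiv.swap (0 : Fin 3) 1) ψ = ψ ∧
        eval (Sum.elim (fun d : DegIndex 1 1 => c.coeff d.1) (fun d : DegIndex 1 (e - 1) => ψ.coeff d.1)) (G i) ≠ 0) ∧
      ∀ c ψ : MvPolynomial (Fin 3) ℂ, c.IsHomogeneous 1 → ψ.IsHomogeneous (e - 1) → rename (Equiv.swap (0 : Fin 3) 1) ψ = ψ →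
        (∀ i, eval (Sum.elim (fun d : DegIndex 1 1 => c.coeff d.1) (fun d : DegIndex 1 (e - 1) => ψ.coeff d.1)) (G i) ≠ 0) →
        ∃ t : ComplexPoints (base W), cOf (coeffs W t) = c ∧ ψOf (coeffs W t) = ψ ∧ (∀ j, t ∉ Bad j) ∧ eval (coeffs W t) g₀ ≠ 0 := by
  classical
  -- ### (1) polynomial descriptions of the `Bad j` and of the complement of `W`
  choose S hS using fun j => exists_set_forall_mem_iff W (Bad j) (hBad j).1
  obtain ⟨S₀, hS₀⟩ := exists_set_exists_point_iff W
  have hF : ∀ j, ∃ F ∈ S j, F ≠ 0 := by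
    intro j
    by_contra h
    push Not at h
    refine (hBad j).2 (Set.eq_univ_of_forall fun t => (hS j t).2 fun F hFS => ?_)
    rw [h F hFS, map_zero]
  choose F hFS hF0 using hF
  have hF₀ : ∃ F ∈ S₀, F ≠ 0 := by
    obtain ⟨t⟩ := hne
    have h := (hS₀ (coeffs W t)).1 ⟨t, rfl⟩
    by_contra h'
    push Not at h'
    exact h fun F hFS => by rw [h' F hFS, map_zero]
  obtain ⟨F₀, hF₀S, hF₀0⟩ := hF₀
  -- the constraints: `f 0 = F₀` (be a point of `W`), `f 1 = g₀`, `f (j + 2) = F j` (avoid `Bad j`)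
  let f : ℕ → ParamRing e := fun i => match i with
    | 0 => F₀
    | 1 => g₀
    | j + 2 => F j
  have hf : ∀ i, f i ≠ 0 := fun i => match i with
    | 0 => hF₀0
    | 1 => hg₀
    | j + 2 => hF0 j
  -- a non-root of each constraint
  have hroot : ∀ i, ∃ a : CIdx e → ℂ, eval a (f i) ≠ 0 := fun i => by
    by_contra h
    push Not at h
    exact hf i (MvPolynomial.funext fun a => by rw [h a, map_zero])
  choose a ha using hroot
  -- ### (2) the coset sweep `A c ψ u` and its two polynomial incarnations
  let k : DegIndex 1 (e - 1) → DegIndex 1 (e - 1) → ℂ := fun d d' =>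
    coeff d.1 (monomial d'.1 (1 : ℂ) - rename (Equiv.swap (0 : Fin 3) 1) (monomial d'.1 (1 : ℂ)))
  let A : MvPolynomial (Fin 3) ℂ → MvPolynomial (Fin 3) ℂ → (DegIndex 1 (e - 1) → ℂ) → CIdx e → ℂ := fun c ψ u =>
    Sum.elim (fun d : DegIndex 1 1 => c.coeff d.1) (fun d : DegIndex 1 (e - 1) => (1 / 2 : ℂ) * ψ.coeff d.1 + ∑ d', k d d' * u d')
  -- in the `(c, ψ)`-coefficients, `u` fixed
  let θ : (DegIndex 1 (e - 1) → ℂ) → CIdx e → MvPolynomial (CIdx e) ℂ := fun u =>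
    Sum.elim (fun d => X (Sum.inl d)) (fun d => C (1 / 2 : ℂ) * X (Sum.inr d) + C (∑ d', k d d' * u d'))
  have hθ : ∀ (c ψ : MvPolynomial (Fin 3) ℂ) (u : DegIndex 1 (e - 1) → ℂ) (p : ParamRing e),
      eval (Sum.elim (fun d : DegIndex 1 1 => c.coeff d.1) (fun d : DegIndex 1 (e - 1) => ψ.coeff d.1)) (bind₁ (θ u) p) =
        eval (A c ψ u) p := by
    intro c ψ u p
    change eval₂Hom (RingHom.id ℂ) _ (bind₁ (θ u) p) = _
    rw [eval₂Hom_bind₁]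
    change eval (fun i => eval _ (θ u i)) p = _
    have hfun : (fun i => eval (Sum.elim (fun d : DegIndex 1 1 => c.coeff d.1) (fun d : DegIndex 1 (e - 1) => ψ.coeff d.1))
        (θ u i)) = A c ψ u := by
      funext i
      rcases i with d | d
      · simp [θ, A]
      · simp [θ, A]
    rw [hfun]
  -- in the coset variable `u`, `(c, ψ)` fixed
  let θ' : MvPolynomial (Fin 3) ℂ → MvPolynomial (Fin 3) ℂ → CIdx e → MvPolynomial (DegIndex 1 (e - 1)) ℂ := fun c ψ =>
    Sum.elim (fun d : DegIndex 1 1 => C (c.coeff d.1))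
      (fun d : DegIndex 1 (e - 1) => C ((1 / 2 : ℂ) * ψ.coeff d.1) + ∑ d', C (k d d') * X d')
  have hθ' : ∀ (c ψ : MvPolynomial (Fin 3) ℂ) (u : DegIndex 1 (e - 1) → ℂ) (p : ParamRing e),
      eval u (bind₁ (θ' c ψ) p) = eval (A c ψ u) p := by
    intro c ψ u p
    change eval₂Hom (RingHom.id ℂ) _ (bind₁ (θ' c ψ) p) = _
    rw [eval₂Hom_bind₁]
    change eval (fun i => eval _ (θ' c ψ i)) p = _
    have hfun : (fun i => eval u (θ' c ψ i)) = A c ψ u := by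
      funext i
      rcases i with d | d
      · simp [θ', A]
      · simp [θ', A]
    rw [hfun]
  -- ### (3) the polynomials: `G i := (f i)(A · · u_i)` with `u_i = ½ a_i|_{ψ₀}`
  refine ⟨fun i => bind₁ (θ (fun d' => (1 / 2 : ℂ) * a i (Sum.inr d'))) (f i), fun i => ?_, fun c ψ hc hψ hψσ hG => ?_⟩
  · -- non-vanishing at the admissible pair `(cOf a_i, ψOf a_i)`: the sweep recovers `a_i`
    refine ⟨cOf (a i), ψOf (a i), isHomogeneous_cOfR _, isHomogeneous_ψOfR _, rename_swap_ψOf _, ?_⟩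
    rw [hθ]
    have hA : A (cOf (a i)) (ψOf (a i)) (fun d' => (1 / 2 : ℂ) * a i (Sum.inr d')) = a i := sweep_eq_self (e := e) (a i)
    rw [hA]
    exact ha i
  · -- ### (4) an admissible pair off the zero sets: a good value of the coset variable
    let p : ℕ → MvPolynomial (DegIndex 1 (e - 1)) ℂ := fun i => bind₁ (θ' c ψ) (f i)
    have hp : ∀ i, p i ≠ 0 := fun i h0 => hG i (by
      change eval _ (bind₁ (θ _) (f i)) = 0
      rw [hθ, ← hθ' c ψ, show bind₁ (θ' c ψ) (f i) = p i from rfl, h0, map_zero])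
    -- `ℂ^{DegIndex}` is not a countable union of hypersurfaces
    let ι := Fintype.equivFin (DegIndex 1 (e - 1))
    obtain ⟨cv, hcv⟩ := exists_forall_eval_ne_zero _ (fun i => rename ι (p i)) fun i h0 =>
      hp i (rename_injective _ ι.injective (by rw [h0, map_zero]))
    let u : DegIndex 1 (e - 1) → ℂ := cv ∘ ι
    have hu : ∀ i, eval (A c ψ u) (f i) ≠ 0 := fun i => by
      rw [← hθ' c ψ u (f i)]
      have h := hcv i
      rwa [eval_rename] at h
    -- the point of `W` with coefficient vector `A c ψ u`
    obtain ⟨t, ht⟩ := (hS₀ (A c ψ u)).2 fun hall => hu 0 (hall F₀ hF₀S)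
    refine ⟨t, ?_, ?_, fun j htj => ?_, ?_⟩
    · rw [ht]; exact (cOf_ψOf_sweep hc hψ hψσ u).1
    · rw [ht]; exact (cOf_ψOf_sweep hc hψ hψσ u).2
    · exact hu (j + 2) (by rw [← ht]; exact (hS j t).1 htj (F j) (hFS j))
    · rw [ht]; exact hu 1

end Summit.HodgeConjecture.HodgeConjecture.Theorems.Q8SymplecticPowersGenericityPolynomials

end
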